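import Summits.Ventures.QEC.Census.CertCoverBatch
import Summits.Ventures.QEC.Census.BB.A1s_n168_k6_2a6ba22a.CoreDefs
import HarnessLib

set_option Elab.async false
set_option maxRecDepth 200000

/-!
# `[[168,6,16]]` one-level cover certificate of `A1s_n168_k6_2a6ba22a` — LEVEL-1→0 coset problems 181…204 (deep problems [10] excluded: `ProbDeep*.lean`) as COMPACT data
(`ProbData`: U, f, σ, y₀, allow; qec-type-10 `CertCoverBatch.mkCoset` rebuilds each `CosetProb` in the kernel) + their verdict
`probsOK cov covR hx hx1 D1 lxd 14` (one `decide +kernel`; 24 problems, depths f=0:22 f=1:2 f=2:0 f=3:0, est. 93.0 s).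
qec-search-1 g5 (pattern of search-9 g5 `Probs*`); data from JSON `level10.problems` (sha256 ac2cc5360adc6451…). Data + decided check; KERNEL.
-/

namespace Summit.Ventures.QEC.Census.A1s_n168_k6_2a6ba22a

open Matrix Summit.Ventures.QEC.Census Literature.InformationTheory.QuantumCodes

/-- Problems 181…204 (24): `⟨U, f, σ, y₀, allow⟩`. -/
def probs04 : List ProbData := [
    ⟨10929878541070518714946, 0, 2483573358848, 295294553919335321140, []⟩,
    ⟨10994404868997951524996, 0, 2208754193552, 1180737021235125577728, []⟩,
    ⟨11289881522248295121152, 0, 2208754447492, 10108965497222187016449, []⟩,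
    ⟨13982636551262192009728, 0, 11911835684, 9776774359134807867928, []⟩,
    ⟨15644028074341444388884, 0, 2762772320392, 295183934251518674038, []⟩,
    ⟨20075138211002060376064, 0, 2217281454624, 18889465966938369843264, []⟩,
    ⟨20367548490868242546752, 0, 3316824146976, 20367548455651858370836, []⟩,
    ⟨23039992374263558438921, 0, 2219441144848, 21859391746072014487553, [0]⟩,
    ⟨30179347308587046142280, 0, 2225934316544, 9445170940940902557026, []⟩,
    ⟨38961906239730032451716, 0, 2509336805697, 4503599628427396, [0]⟩,
    ⟨38974693999963017315460, 0, 2234470504576, 1189959108079852324000, []⟩,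
    ⟨38996529843296578601108, 0, 2509468926208, 38959595822752446021648, [0]⟩,
    ⟨39255252652281878061200, 0, 2509368725777, 580981944116879488, [0]⟩,
    ⟨39292142481265087512836, 0, 35434009616, 576478361686147076, [0]⟩,
    ⟨39421306899451413004289, 0, 2234876693568, 37926541914712601264133, []⟩,
    ⟨48410201412045406994436, 1, 2243052048576, 48410165383231206064164, [32, 262144, 2147483648]⟩,
    ⟨48445943104588140773636, 0, 2243084555456, 4791970758207471616, []⟩,
    ⟨53463312603375715024930, 0, 2247446497792, 4763872219991980621847, []⟩,
    ⟨76749012927671863083141, 0, 2268826046480, 1189960233860519202956, []⟩,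
    ⟨76757230906426612514816, 0, 2268833517616, 76738455346804585072910, []⟩,
    ⟨76969112848639278194720, 0, 2268892038161, 75640875217743482204425, []⟩,
    ⟨79266994744990866868224, 0, 2821140383872, 147718208550163767329, []⟩,
    ⟨114559038346124517703680, 1, 104190838416, 75562620248400471523328, [262144]⟩,
    ⟨124294775817422904524800, 0, 2311766672960, 75558476778413616037892, []⟩]

set_option maxHeartbeats 400000000 in
/-- Every problem of this chunk passes (`mkCoset` elimination + `cosetOKD` + fast `σ` + depth + `BU`-evenness + label checks). -/
theorem probs04_ok : probsOK A1s_n168_k6_2a6ba22a.cov covR hx hx1 D1 lxd 14 probs04 = true := by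
  decide +kernel

/-- Pointwise form. -/
theorem probs04_all : ∀ x ∈ A1s_n168_k6_2a6ba22a.probs04, probOK cov covR hx hx1 D1 lxd 14 x = true := by
  have h := probs04_ok
  rwa [probsOK, List.all_eq_true] at h

end Summit.Ventures.QEC.Census.A1s_n168_k6_2a6ba22a
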